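import Summits.BirchSwinnertonDyer.BirchSwinnertonDyer.Theorems.CMKolyvaginAtInertTwoInertOrderSplittingIsogeny
import HarnessLib

/-!
# Route `CMKolyvaginAtInertTwo`, crux `CMKolyvaginExactAtInertTwo` (stmt-BirchSwinnertonDyer-24277):
# the exact Selmer splitting of the Morita frame on `H₂` (maximal orders), modulo the ONE named fact
# `Isogeny.hasLocalPointsMaps`

Seat `bsd-line-cmk2-p1` g10 (cell `bsd-print-cf2`); helper (`--supports stmt-BirchSwinnertonDyer-24277`).
THEOREMS ONLY: no definition, no named fact, no `sorry`; no item is closed; BSD is not proved by this.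
Memo `Cruxes/CMExactDescentAtTwo/MEMO-inert-order-splitting.md` §§3–5.

`natCard_selmer_eq_sq_of_habitat` — for `E/ℚ` with CM, `2` inert in the CM field `F`, `ρ̄_{E,2}` onto and
`j(E) ≠ −12288000` (the six maximal inert orders); `K` imaginary quadratic (in applications the Heegner
field); `L ⊇ K` with `[L : K] = 2`, normal over `ℚ`, totally complex, `√d_F ∈ L` (in applications
`L = K·F`); `σ` = the restriction to `L` of a (transported) complex conjugation `c₀`; GRANTED the named
fact `Isogeny.hasLocalPointsMaps (W⁄L) (W⁄L)` (Silverman III.4: an isogeny acts equivariantly on the points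
over every field): **`#Sel_{2^M}(E_L/L) = (#Sel_{2^M}(E_L/L)^{σ})²` for every `M`**. The case split on
`d_F ∈ {−3, −11, −19, −43, −67, −163}` is ty2's (`CartanAtTwo.smul_comm_of_hasCM_of_cmInert_two`);
`Δ < 0` is g2's `Δ_neg_of_cmInert_two`; `√d_F ∈ L ⟹ Δ ∈ L^{×2}` is `isSquare_Δ_baseChange_of_isSquare_cmFieldDiscr`.
References: Lang, *Elliptic Functions*, Ch. 10 §4 [Lang1987]; Silverman *AEC* III.§4 [SilvermanAEC2009];
Silverman *Advanced Topics* App. A §3 [SilvermanATAEC1994].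
-/

-- single-conjunct summit: `Summit.BirchSwinnertonDyer.BirchSwinnertonDyer.…` repeats the name by design
set_option linter.dupNamespace false
set_option autoImplicit false

noncomputable section

open scoped Classical

namespace Summit.BirchSwinnertonDyer.BirchSwinnertonDyer.Theorems.InertOrderSplittingHabitat

open WeierstrassCurve Field NumberField
open Literature.NumberTheory.EllipticCurves Literature.NumberTheory.EllipticCurves.Rank1Residual
open Literature.NumberTheory.GaloisRepresentations
open Summit.BirchSwinnertonDyer.Rank1Residual Summit.BirchSwinnertonDyer.Rank1Residual.P2
open Summit.BirchSwinnertonDyer.BirchSwinnertonDyer.Theorems.KolyvaginEigenTwo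

variable (W : WeierstrassCurve ℚ) [W.IsElliptic] {L : Type} [Field L] [NumberField L]
variable {c₀ : absoluteGaloisGroup ℚ}

/-- **THE EXACT SELMER SPLITTING ON `H₂` (maximal orders), modulo `Isogeny.hasLocalPointsMaps`.**
[cite: Lang1987, Ch. 10 §4, Remark] [cite: SilvermanAEC2009, III.§4] [cite: SilvermanATAEC1994, App. A §3] -/
theorem natCard_selmer_eq_sq_of_habitat [Normal ℚ L] (hCM : W.HasCM) (hin : CMInert W 2)
    (hsurj : W.HasSurjectiveModNGaloisRep 2) (hj12 : W.j ≠ -12288000)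
    (K : Type) [Field K] [NumberField K] (hK : IsImaginaryQuadratic K) [Algebra K L]
    (hLK : Module.finrank K L = 2) (hLc : ∀ w : InfinitePlace L, w.IsComplex)
    (hF : IsSquare (algebraMap ℚ L (cmFieldDiscrOfJ W.j))) (hc₀ : IsComplexConjugation (Rat.castHom ℝ) c₀)
    (hX : Isogeny.hasLocalPointsMaps (W.baseChange L) (W.baseChange L)) (M : ℕ) :
    Nat.card (selmerGroup (W.baseChange L) ((2 : ℤ) ^ M)) =
      Nat.card {x : selmerGroup (W.baseChange L) ((2 : ℤ) ^ M) //
        conjAct W ((absGaloisTransport (K := ℚ) (L := L) c₀).restrictNormal L) _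
          (x : galH1Torsion (W.baseChange L) ((2 : ℤ) ^ M)) = x} ^ 2 := by
  have hΔ : W.Δ < 0 := Δ_neg_of_cmInert_two W hCM hin hsurj
  have hΔL : IsSquare (W.baseChange L).Δ := isSquare_Δ_baseChange_of_isSquare_cmFieldDiscr W L hCM hin hsurj hF
  have h54 : W.j ≠ 54000 := fun hj ↦ InertAtlas.not_hasSurjectiveModNGaloisRep_two_of_j_eq_54000 W hj hsurj
  have main : ∀ {d c : ℤ}, W.j ∈ maximalCMJInvariants → cmDiscr W.j = d → d * (d - 1) = 4 * c → Odd d →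
      Odd c → Nat.card (selmerGroup (W.baseChange L) ((2 : ℤ) ^ M)) =
      Nat.card {x : selmerGroup (W.baseChange L) ((2 : ℤ) ^ M) //
        conjAct W ((absGaloisTransport (K := ℚ) (L := L) c₀).restrictNormal L) _
          (x : galH1Torsion (W.baseChange L) ((2 : ℤ) ^ M)) = x} ^ 2 :=
    fun hj hd hcd hodd hoddc ↦ natCard_selmer_eq_sq_of_isogenyLocalPointsMaps W hj hd hcd hodd hoddc hΔ hsurj
      K hK.1 hLK hLc hΔL hc₀ hX M
  rcases (cmInert_two_iff_of_hasCM (hcm := hCM)).1 hin with h | h | h | h | h | h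
  · rcases X12.j_eq_of_cmFieldDiscrOfJ_eq_neg_three h with hj | hj | hj
    · exact main (d := -3) (c := 3) (by rw [hj]; simp [maximalCMJInvariants]) (by rw [hj]; norm_num [cmDiscr])
        (by norm_num) (by decide) (by decide)
    · exact absurd hj h54
    · exact absurd hj hj12
  · have hj := X12.j_eq_of_cmFieldDiscrOfJ_eq_neg_eleven h
    exact main (d := -11) (c := 33) (by rw [hj]; simp [maximalCMJInvariants]) (by rw [hj]; norm_num [cmDiscr])
      (by norm_num) (by decide) (by decide)
  · have hj := X12.j_eq_of_cmFieldDiscrOfJ_eq_neg_nineteen h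
    exact main (d := -19) (c := 95) (by rw [hj]; simp [maximalCMJInvariants]) (by rw [hj]; norm_num [cmDiscr])
      (by norm_num) (by decide) (by decide)
  · have hj := X12.j_eq_of_cmFieldDiscrOfJ_eq_neg_fortythree h
    exact main (d := -43) (c := 473) (by rw [hj]; simp [maximalCMJInvariants]) (by rw [hj]; norm_num [cmDiscr])
      (by norm_num) (by decide) (by decide)
  · have hj := X12.j_eq_of_cmFieldDiscrOfJ_eq_neg_sixtyseven h
    exact main (d := -67) (c := 1139) (by rw [hj]; simp [maximalCMJInvariants]) (by rw [hj]; norm_num [cmDiscr])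
      (by norm_num) (by decide) (by decide)
  · have hj := X12.j_eq_of_cmFieldDiscrOfJ_eq_neg_onesixtythree h
    exact main (d := -163) (c := 6683) (by rw [hj]; simp [maximalCMJInvariants]) (by rw [hj]; norm_num [cmDiscr])
      (by norm_num) (by decide) (by decide)

end Summit.BirchSwinnertonDyer.BirchSwinnertonDyer.Theorems.InertOrderSplittingHabitat
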